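import Literature.Geometry.Riemannian.MeanConvexContractible
import Literature.Geometry.Lorentzian.HypersurfaceNaturality
import Literature.Geometry.Lorentzian.CurvatureNaturality
import Literature.Geometry.Riemannian.ChangGurskyYangProofs
import Literature.Topology.FourManifolds.KnotFraming
import HarnessLib

/-!
# Sweeney 2026, Prop. 1.2 — the geometric reduction (proofs)

Sibling proof file of `MeanConvexContractible.lean` (the named fact
`Literature.Geometry.Riemannian.Sweeney2026_pscMeanConvex`: every compact contractible
`(n+1)`-manifold with boundary, Mazur if `n = 3`, carries a metric of positive scalar curvature
with mean-convex boundary; P. Sweeney Jr., *Positive curvature conditions on contractible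
manifolds*, Math. Ann. (2026), Prop. 1.2, printed WITHOUT proof as a consequence of
Lawson–Michelsohn, Invent. Math. 77 (1984)).

The unprinted argument has a topological half — the manifold `X` embeds smoothly, in codimension
`0`, into the round sphere `S^{n+1}` (h-cobordism theorem for `n ≥ 4`, Mazur's theorem for
`n = 3`, Perelman for `n = 2`) and by Lawson–Michelsohn's Thm. 1 the image can be isotoped until
its boundary has positive mean curvature — and a geometric half: pull the ambient metric back.
This file PROVES the geometric half, for an arbitrary Riemannian target, in the exact vocabulary
of the fact:

* `contMDiffAt_inverse_mfderiv_apply` — pulling a smooth field along `Φ ∘ f` back by the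
  differentials of an equidimensional immersion `Φ` gives a smooth field along `f`
  (Mathlib's `ContMDiffAt.clm_apply_of_inCoordinates`, inversion being smooth);
* `pscMeanConvex_of_immersion` — **the reduction**: if a manifold with boundary `X^{n+1}`
  admits a smooth map `Φ : X → M` with injective differentials into a Riemannian
  `(n+1)`-manifold `(M, g_M)` whose scalar curvature is positive on `Φ(X)`, and `Φ ∘ incl_{∂X}`
  carries a smooth `g_M`-unit normal field `ν_M`, pointing out of `X` (its preimage under `dΦ`
  has negative first half-space coordinate) and of positive mean curvature `H = tr K_{ν_M}`, then
  `X` carries a Riemannian metric (namely `Φ^* g_M`) with Levi-Civita connection, positive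
  scalar curvature, for which `incl_{∂X}` is a spacelike immersion with the smooth outward unit
  normal `(dΦ)⁻¹ ν_M` of positive mean curvature — i.e. the conclusion of
  `Sweeney2026_pscMeanConvex` for this `X`. Ingredients: naturality of the scalar curvature
  (`PseudoRiemannianMetric.scalarCurvature_comap`, file `Lorentzian/CurvatureNaturality.lean`)
  and of the mean curvature (`PseudoRiemannianMetric.meanCurvature_comap`, file
  `Lorentzian/HypersurfaceNaturality.lean`), existence of the Levi-Civita connection
  (`PseudoRiemannianMetric.hasLeviCivita`).
* `pscMeanConvex_of_sphereImmersion` — the case `M = S^{n+1}` round (unit sphere of an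
  `(n+2)`-dimensional inner product space, `roundMetric`; its scalar curvature `n(n+1)` is positive,
  `scalarCurvature_roundMetric_pos` of `ChangGurskyYangProofs.lean`): what remains to be supplied
  is exactly a codimension-`0` immersion into the round sphere under which the boundary is mean
  convex — the output of Lawson–Michelsohn's Thm. 1.
* `Sweeney2026_pscMeanConvex_of_meanConvexImmersion`, `Sweeney2026_pscMeanConvex_of_sphereImmersion`
  — the named fact follows from the topological half, spelled out inline as a hypothesis (NOT a
  new named fact): for every `X` as in the fact there is such a `(M, g_M, Φ, ν_M)`, resp. such a
  `(Φ, ν_M)` into a round `S^{n+1}` (the form Lawson–Michelsohn's theorem delivers).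

What is NOT here: the topological half (no h-cobordism theorem / Lawson–Michelsohn Thm. 1 in the
tree), hence no `Sweeney2026_pscMeanConvex_holds` yet.

## References

* P. Sweeney Jr., *Positive curvature conditions on contractible manifolds*, Math. Ann. (2026)
  = arXiv:2507.15719, Prop. 1.2 (p. 4: "a result of Lawson and Michelsohn … implies the
  following"). [Sweeney2026]
* H. B. Lawson, M.-L. Michelsohn, *Embedding and surrounding with positive mean curvature*,
  Invent. Math. 77 (1984) 399–419, Thm. 1. [LawsonMichelsohn1984]
* B. O'Neill, *Semi-Riemannian geometry* (1983), Ch. 3, Prop. 3.59; Ch. 4, Lemma 4.4 ff.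
  [ONeill1983]
-/

noncomputable section

open scoped Manifold ContDiff Topology
open Bundle Set Function Filter ContinuousLinearMap
open Literature.Geometry.Lorentzian Literature.Topology.FourManifolds

namespace Literature.Geometry.Riemannian

/-! ### Pulling a field along a map back by an equidimensional immersion -/

section Pullback

variable {E : Type*} [NormedAddCommGroup E] [NormedSpace ℝ E] {H : Type*} [TopologicalSpace H]
  {I : ModelWithCorners ℝ E H} {M : Type*} [TopologicalSpace M] [ChartedSpace H M]
  [IsManifold I ∞ M]
  {E' : Type*} [NormedAddCommGroup E'] [NormedSpace ℝ E'] {H' : Type*} [TopologicalSpace H']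
  {I' : ModelWithCorners ℝ E' H'} {N : Type*} [TopologicalSpace N] [ChartedSpace H' N]
  [IsManifold I' ∞ N] [CompleteSpace E']
  {E'' : Type*} [NormedAddCommGroup E''] [NormedSpace ℝ E''] {H'' : Type*}
  [TopologicalSpace H''] {I'' : ModelWithCorners ℝ E'' H''} {P : Type*} [TopologicalSpace P]
  [ChartedSpace H'' P]

/-- **Pulling back a smooth field along a map by an equidimensional immersion.** Let
`Φ : N → M` be smooth with every differential invertible, `f : P → N` smooth at `y₀`, and `V` a
field along `Φ ∘ f` (`V y ∈ T_{Φ (f y)} M`) which is smooth at `y₀` as a map `P → TM`. Then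
`y ↦ (dΦ_{f y})⁻¹ (V y)`, a field along `f`, is smooth at `y₀` as a map `P → TN`: apply the
linear maps `(dΦ_{f y})⁻¹`, which depend smoothly on `y` when read in coordinates (the
differential does, `ContMDiffAt.mfderiv_const`, and inversion is smooth at invertible maps,
`ContinuousLinearMap.IsInvertible.contDiffAt_map_inverse`), to the smooth field `V`
(`ContMDiffAt.clm_apply_of_inCoordinates`); the pattern of Mathlib's
`ContMDiffWithinAt.mpullbackWithin_vectorField_inter`. [folklore] -/
theorem contMDiffAt_inverse_mfderiv_apply {Φ : N → M} (hΦ : ContMDiff I' I ∞ Φ)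
    (hinv : ∀ u, (mfderiv I' I Φ u).IsInvertible) {f : P → N}
    {V : Π y : P, TangentSpace I (Φ (f y))} {y₀ : P} (hf : ContMDiffAt I'' I' ∞ f y₀)
    (hV : ContMDiffAt I'' I.tangent ∞
      (fun y ↦ (TotalSpace.mk' E (Φ (f y)) (V y) : TangentBundle I M)) y₀) :
    ContMDiffAt I'' I'.tangent ∞
      (fun y ↦ (TotalSpace.mk' E' (f y) ((mfderiv I' I Φ (f y)).inverse (V y)) :
        TangentBundle I' N)) y₀ := by
  -- the differential of `Φ` read in coordinates depends smoothly on the point, also along `f`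
  have h1 : ContMDiffAt I' 𝓘(ℝ, E' →L[ℝ] E) ∞
      (inTangentCoordinates I' I id Φ (mfderiv I' I Φ) (f y₀)) (f y₀) :=
    (hΦ (f y₀)).mfderiv_const le_rfl
  have h2 : ContMDiffAt I'' 𝓘(ℝ, E' →L[ℝ] E) ∞ (fun y ↦ inCoordinates E' (TangentSpace I')
      E (TangentSpace I) (f y₀) (f y) (Φ (f y₀)) (Φ (f y)) (mfderiv I' I Φ (f y))) y₀ :=
    h1.comp y₀ hf
  -- hence so does its inverse
  have h3 : ContMDiffAt I'' 𝓘(ℝ, E →L[ℝ] E') ∞ (ContinuousLinearMap.inverse ∘ fun y ↦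
      inCoordinates E' (TangentSpace I') E (TangentSpace I) (f y₀) (f y) (Φ (f y₀)) (Φ (f y))
        (mfderiv I' I Φ (f y))) y₀ := by
    apply ContMDiffAt.comp y₀ _ h2
    apply ContDiffAt.contMDiffAt
    apply IsInvertible.contDiffAt_map_inverse
    rw [inCoordinates_eq (FiberBundle.mem_baseSet_trivializationAt' (f y₀))
      (FiberBundle.mem_baseSet_trivializationAt' (Φ (f y₀)))]
    exact isInvertible_equiv.comp ((hinv _).comp isInvertible_equiv)
  -- and the inverse in coordinates is the in-coordinates expression of the inverse
  have h4 : ContMDiffAt I'' 𝓘(ℝ, E →L[ℝ] E') ∞ (fun y ↦ inCoordinates E (TangentSpace I)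
      E' (TangentSpace I') (Φ (f y₀)) (Φ (f y)) (f y₀) (f y)
        ((mfderiv I' I Φ (f y)).inverse)) y₀ := by
    apply h3.congr_of_eventuallyEq
    have A : ∀ᶠ y in 𝓝 y₀, f y ∈ (trivializationAt E' (TangentSpace I') (f y₀)).baseSet :=
      hf.continuousAt.preimage_mem_nhds ((trivializationAt E' (TangentSpace I' : N → Type _)
        (f y₀)).open_baseSet.mem_nhds (FiberBundle.mem_baseSet_trivializationAt' (f y₀)))
    have B : ∀ᶠ y in 𝓝 y₀, Φ (f y) ∈ (trivializationAt E (TangentSpace I) (Φ (f y₀))).baseSet :=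
      ((hΦ.continuous.continuousAt).comp hf.continuousAt).preimage_mem_nhds
        ((trivializationAt E (TangentSpace I : M → Type _) (Φ (f y₀))).open_baseSet.mem_nhds
          (FiberBundle.mem_baseSet_trivializationAt' (Φ (f y₀))))
    filter_upwards [A, B] with y hy h'y
    simp only [Function.comp_apply]
    rw [inCoordinates_eq hy h'y, inCoordinates_eq h'y (by exact hy)]
    simp only [inverse_equiv_comp, inverse_comp_equiv, ContinuousLinearEquiv.symm_symm]
    rfl
  exact ContMDiffAt.clm_apply_of_inCoordinates
    (ϕ := fun y ↦ (mfderiv I' I Φ (f y)).inverse) h4 hV hf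

end Pullback

/-! ### The reduction of Sweeney's Prop. 1.2 to an immersion into a mean-convex image -/

/-- **Sweeney 2026, Prop. 1.2 — the geometric half (PROVED).** Let `X` be a smooth
`(n+1)`-manifold with boundary with boundary datum `bX`, `(M, g_M)` a Riemannian
`(n+1)`-manifold (smooth metric with Levi-Civita connection), and `Φ : X → M` a smooth map all of
whose differentials are injective (a codimension-`0` immersion, e.g. a smooth embedding onto a
compact domain of the round sphere), such that: the scalar curvature of `g_M` is positive on
`Φ(X)`; `Φ ∘ incl_{∂X}` is a spacelike immersion carrying a `g_M`-unit normal field `ν_M`, smooth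
as a map `∂X → TM`, OUTWARD in the sense that `(dΦ)⁻¹ ν_M` has negative first half-space
coordinate in the boundary charts of `X`, and of positive mean curvature
`H = tr K_{ν_M} > 0` (the tree's `meanCurvature`, sign convention `K_ν(v,w) = +g(D_v ν, d(Φ∘incl) w)`,
so that round balls are mean convex for the outward normal). Then `X` carries a Riemannian metric
— the pullback `Φ^* g_M` — with Levi-Civita connection and positive scalar curvature, for which
`incl_{∂X}` is a spacelike immersion with smooth outward unit normal `(dΦ)⁻¹ ν_M` of positive mean
curvature: the conclusion of `Sweeney2026_pscMeanConvex` for `X`. Proof: `S^{Φ^*g_M} = S^{g_M} ∘ Φ`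
(`scalarCurvature_comap`), `H^{Φ^*g_M}_{incl, (dΦ)⁻¹ν_M} = H^{g_M}_{Φ∘incl, ν_M}`
(`meanCurvature_comap`), and `(dΦ)⁻¹ ν_M` is smooth (`contMDiffAt_inverse_mfderiv_apply`).
This is the (routine, unprinted) step "pull back the round metric" of the argument indicated in
Sweeney 2026, p. 4, for Prop. 1.2. [cite: Sweeney2026, Prop. 1.2] -/
theorem pscMeanConvex_of_immersion (n : ℕ) (X : Type*) [TopologicalSpace X]
    [ChartedSpace (EuclideanHalfSpace (n + 1)) X] [IsManifold (𝓡∂ (n + 1)) ∞ X]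
    (bX : BoundaryData (𝓡∂ (n + 1)) X (𝓡 n))
    {M : Type*} [TopologicalSpace M] [ChartedSpace (EuclideanSpace ℝ (Fin (n + 1))) M]
    [IsManifold (𝓡 (n + 1)) ∞ M]
    (gM : PseudoRiemannianMetric (𝓡 (n + 1)) ∞ (EuclideanSpace ℝ (Fin (n + 1)))
      (TangentSpace (𝓡 (n + 1)) : M → Type _)) [gM.HasLeviCivita] (hgM : gM.IsRiemannian)
    {Φ : X → M} (hΦ : ContMDiff (𝓡∂ (n + 1)) (𝓡 (n + 1)) ∞ Φ)
    (hΦ' : ∀ x, Injective (mfderiv (𝓡∂ (n + 1)) (𝓡 (n + 1)) Φ x))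
    (hS : ∀ x, 0 < gM.scalarCurvature (Φ x))
    (hΦb : gM.IsSpacelikeImmersion (𝓡 n) (Φ ∘ bX.incl))
    {νM : NormalField (𝓡 (n + 1)) (Φ ∘ bX.incl)}
    (hν : gM.IsUnitNormal (𝓡 n) (Φ ∘ bX.incl) νM 1)
    (hνs : ContMDiff (𝓡 n) (𝓡 (n + 1)).tangent ∞
      (fun z ↦ (TotalSpace.mk' (EuclideanSpace ℝ (Fin (n + 1))) (Φ (bX.incl z)) (νM z) :
        TangentBundle (𝓡 (n + 1)) M)))
    (hout : ∀ z, (show EuclideanSpace ℝ (Fin (n + 1)) from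
      (mfderiv (𝓡∂ (n + 1)) (𝓡 (n + 1)) Φ (bX.incl z)).inverse (νM z)) 0 < 0)
    (hH : ∀ z, 0 < gM.meanCurvature (Φ ∘ bX.incl)
      PseudoRiemannianMetric.contMDiff_pullbackBilin_holds hΦb νM z) :
    ∃ g : PseudoRiemannianMetric (𝓡∂ (n + 1)) ∞ (EuclideanSpace ℝ (Fin (n + 1)))
        (TangentSpace (𝓡∂ (n + 1)) : X → Type _),
    ∃ _ : g.HasLeviCivita, ∃ hf : g.IsSpacelikeImmersion (𝓡 n) bX.incl,
    ∃ ν : NormalField (𝓡∂ (n + 1)) bX.incl,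
      g.IsRiemannian ∧ (∀ x, 0 < g.scalarCurvature x) ∧ g.IsUnitNormal (𝓡 n) bX.incl ν 1 ∧
      ContMDiff (𝓡 n) (𝓡∂ (n + 1)).tangent ∞
        (fun z ↦ (TotalSpace.mk' (EuclideanSpace ℝ (Fin (n + 1))) (bX.incl z) (ν z) :
          TangentBundle (𝓡∂ (n + 1)) X)) ∧
      (∀ z, (show EuclideanSpace ℝ (Fin (n + 1)) from ν z) 0 < 0) ∧
      ∀ z, 0 < g.meanCurvature bX.incl
        PseudoRiemannianMetric.contMDiff_pullbackBilin_holds hf ν z := by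
  have hdim : Module.finrank ℝ (EuclideanSpace ℝ (Fin (n + 1))) =
      Module.finrank ℝ (EuclideanSpace ℝ (Fin (n + 1))) := rfl
  have hΦ1 : ContMDiff (𝓡∂ (n + 1)) (𝓡 (n + 1)) (∞ + 1) Φ := hΦ
  have hpb : PseudoRiemannianMetric.contMDiff_pullbackBilin (𝓡 (n + 1)) M (𝓡∂ (n + 1)) X ∞ :=
    PseudoRiemannianMetric.contMDiff_pullbackBilin_holds
  -- the pullback metric and its Levi-Civita connection
  haveI hLC : (gM.comap hpb Φ hΦ1 hΦ' hdim).HasLeviCivita :=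
    (gM.comap hpb Φ hΦ1 hΦ' hdim).hasLeviCivita
  have hinv : ∀ x, (mfderiv (𝓡∂ (n + 1)) (𝓡 (n + 1)) Φ x).IsInvertible := fun x ↦
    PseudoRiemannianMetric.isInvertible_mfderiv_of_injective hdim (hΦ' x)
  -- the boundary inclusion
  have hincl : ContMDiff (𝓡 n) (𝓡∂ (n + 1)) ∞ bX.incl := bX.isSmoothEmbedding.contMDiff
  have hincl_inj : ∀ z, Injective (mfderiv (𝓡 n) (𝓡∂ (n + 1)) bX.incl z) := fun z ↦
    Literature.Topology.FourManifolds.Manifold.IsImmersionAt.mfderiv_injective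
      (bX.isSmoothEmbedding.isImmersion.isImmersionAt z) (by simp)
  have hincl_d : ∀ z, MDifferentiableAt (𝓡 n) (𝓡∂ (n + 1)) bX.incl z := fun z ↦
    (hincl z).mdifferentiableAt (by simp)
  have hΦd : ∀ x, MDifferentiableAt (𝓡∂ (n + 1)) (𝓡 (n + 1)) Φ x := fun x ↦
    (hΦ x).mdifferentiableAt (by simp)
  have hchain : ∀ z (w : TangentSpace (𝓡 n) z),
      mfderiv (𝓡 n) (𝓡 (n + 1)) (Φ ∘ bX.incl) z w =
        mfderiv (𝓡∂ (n + 1)) (𝓡 (n + 1)) Φ (bX.incl z)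
          (mfderiv (𝓡 n) (𝓡∂ (n + 1)) bX.incl z w) := fun z w ↦ by
    rw [mfderiv_comp z (hΦd _) (hincl_d z)]
    rfl
  -- the values of the pullback metric
  have hval : ∀ x (v w : TangentSpace (𝓡∂ (n + 1)) x), (gM.comap hpb Φ hΦ1 hΦ' hdim).val x v w =
      gM.val (Φ x) (mfderiv (𝓡∂ (n + 1)) (𝓡 (n + 1)) Φ x v)
        (mfderiv (𝓡∂ (n + 1)) (𝓡 (n + 1)) Φ x w) := fun x v w ↦ rfl
  -- (1) the pullback metric is Riemannian
  have hriem : (gM.comap hpb Φ hΦ1 hΦ' hdim).IsRiemannian := fun x v hv ↦ by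
    rw [hval]
    exact hgM _ _ fun h0 ↦ hv (hΦ' x (h0.trans (map_zero _).symm))
  -- (2) the boundary inclusion is a spacelike immersion
  have hf : (gM.comap hpb Φ hΦ1 hΦ' hdim).IsSpacelikeImmersion (𝓡 n) bX.incl := by
    refine ⟨hincl, fun z v hv ↦ ?_⟩
    rw [PseudoRiemannianMetric.inducedBilin_apply, hval]
    refine hgM _ _ fun h0 ↦ hv (hincl_inj z ?_)
    rw [map_zero]
    exact hΦ' _ (h0.trans (map_zero _).symm)
  -- (3) the pulled-back normal: unit, normal, smooth
  set ν : NormalField (𝓡∂ (n + 1)) bX.incl := fun z ↦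
    (mfderiv (𝓡∂ (n + 1)) (𝓡 (n + 1)) Φ (bX.incl z)).inverse (νM z) with hν_def
  have hΦν : ∀ z, mfderiv (𝓡∂ (n + 1)) (𝓡 (n + 1)) Φ (bX.incl z) (ν z) = νM z := fun z ↦
    (hinv _).self_apply_inverse _
  have hunit : (gM.comap hpb Φ hΦ1 hΦ' hdim).IsUnitNormal (𝓡 n) bX.incl ν 1 := by
    refine ⟨fun z v ↦ ?_, fun z ↦ ?_⟩
    · rw [hval, hΦν, ← hchain]
      exact hν.1 z v
    · rw [hval, hΦν]
      exact hν.2 z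
  have hνs' : ContMDiff (𝓡 n) (𝓡∂ (n + 1)).tangent ∞
      (fun z ↦ (TotalSpace.mk' (EuclideanSpace ℝ (Fin (n + 1))) (bX.incl z) (ν z) :
        TangentBundle (𝓡∂ (n + 1)) X)) := fun z ↦
    contMDiffAt_inverse_mfderiv_apply hΦ hinv (hincl z) (hνs z)
  -- (4) the mean curvature of the boundary is that of its image
  have hmean : ∀ z, (gM.comap hpb Φ hΦ1 hΦ' hdim).meanCurvature bX.incl
      PseudoRiemannianMetric.contMDiff_pullbackBilin_holds hf ν z =
        gM.meanCurvature (Φ ∘ bX.incl) PseudoRiemannianMetric.contMDiff_pullbackBilin_holds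
          hΦb νM z := fun z ↦ by
    have h := gM.meanCurvature_comap hpb hΦ1 hΦ' hdim
      PseudoRiemannianMetric.contMDiff_pullbackBilin_holds
      PseudoRiemannianMetric.contMDiff_pullbackBilin_holds hf hΦb (ν := ν) (y := z)
      BoundarylessManifold.isInteriorPoint ((hνs' z).mdifferentiableAt (by simp))
    rw [h]
    congr 1
    funext w
    exact hΦν w
  refine ⟨gM.comap hpb Φ hΦ1 hΦ' hdim, hLC, hf, ν, hriem, fun x ↦ ?_, hunit, hνs', hout,
    fun z ↦ ?_⟩
  · rw [gM.scalarCurvature_comap hpb hΦ1 hΦ' hdim x]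
    exact hS x
  · rw [hmean z]
    exact hH z

/-- **Sweeney 2026, Prop. 1.2 — the geometric half, round-sphere form (PROVED).** If a smooth
`(n+1)`-manifold with boundary `X`, `n ≥ 1`, admits a smooth map `Φ` with injective
differentials into the round unit sphere `S^{n+1} ⊆ V` (`dim V = n + 2`, metric `roundMetric`)
such that `Φ ∘ incl_{∂X}` is a spacelike immersion with a smooth outward (`(dΦ)⁻¹ ν_M` has
negative first half-space coordinate) round-unit normal field `ν_M` of positive round mean
curvature, then `X` carries a Riemannian metric with Levi-Civita connection and positive scalar
curvature whose boundary is a spacelike immersion with smooth outward unit normal of positive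
mean curvature (`pscMeanConvex_of_immersion` with `S_{round} = n(n+1) > 0`,
`scalarCurvature_roundMetric_pos`). With `Φ` the Lawson–Michelsohn embedding of a compact
contractible `X` this is the argument indicated for Prop. 1.2 in Sweeney 2026, p. 4.
[cite: Sweeney2026, Prop. 1.2] -/
theorem pscMeanConvex_of_sphereImmersion (n : ℕ) (hn : 1 ≤ n) (X : Type*) [TopologicalSpace X]
    [ChartedSpace (EuclideanHalfSpace (n + 1)) X] [IsManifold (𝓡∂ (n + 1)) ∞ X]
    (bX : BoundaryData (𝓡∂ (n + 1)) X (𝓡 n))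
    (V : Type*) [NormedAddCommGroup V] [InnerProductSpace ℝ V]
    [Fact (Module.finrank ℝ V = (n + 1) + 1)] [(roundMetric (n := n + 1) V).HasLeviCivita]
    {Φ : X → Metric.sphere (0 : V) 1} (hΦ : ContMDiff (𝓡∂ (n + 1)) (𝓡 (n + 1)) ∞ Φ)
    (hΦ' : ∀ x, Injective (mfderiv (𝓡∂ (n + 1)) (𝓡 (n + 1)) Φ x))
    (hΦb : (roundMetric (n := n + 1) V).IsSpacelikeImmersion (𝓡 n) (Φ ∘ bX.incl))
    {νM : NormalField (𝓡 (n + 1)) (Φ ∘ bX.incl)}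
    (hν : (roundMetric (n := n + 1) V).IsUnitNormal (𝓡 n) (Φ ∘ bX.incl) νM 1)
    (hνs : ContMDiff (𝓡 n) (𝓡 (n + 1)).tangent ∞
      (fun z ↦ (TotalSpace.mk' (EuclideanSpace ℝ (Fin (n + 1))) (Φ (bX.incl z)) (νM z) :
        TangentBundle (𝓡 (n + 1)) (Metric.sphere (0 : V) 1))))
    (hout : ∀ z, (show EuclideanSpace ℝ (Fin (n + 1)) from
      (mfderiv (𝓡∂ (n + 1)) (𝓡 (n + 1)) Φ (bX.incl z)).inverse (νM z)) 0 < 0)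
    (hH : ∀ z, 0 < (roundMetric (n := n + 1) V).meanCurvature (Φ ∘ bX.incl)
      PseudoRiemannianMetric.contMDiff_pullbackBilin_holds hΦb νM z) :
    ∃ g : PseudoRiemannianMetric (𝓡∂ (n + 1)) ∞ (EuclideanSpace ℝ (Fin (n + 1)))
        (TangentSpace (𝓡∂ (n + 1)) : X → Type _),
    ∃ _ : g.HasLeviCivita, ∃ hf : g.IsSpacelikeImmersion (𝓡 n) bX.incl,
    ∃ ν : NormalField (𝓡∂ (n + 1)) bX.incl,
      g.IsRiemannian ∧ (∀ x, 0 < g.scalarCurvature x) ∧ g.IsUnitNormal (𝓡 n) bX.incl ν 1 ∧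
      ContMDiff (𝓡 n) (𝓡∂ (n + 1)).tangent ∞
        (fun z ↦ (TotalSpace.mk' (EuclideanSpace ℝ (Fin (n + 1))) (bX.incl z) (ν z) :
          TangentBundle (𝓡∂ (n + 1)) X)) ∧
      (∀ z, (show EuclideanSpace ℝ (Fin (n + 1)) from ν z) 0 < 0) ∧
      ∀ z, 0 < g.meanCurvature bX.incl
        PseudoRiemannianMetric.contMDiff_pullbackBilin_holds hf ν z :=
  pscMeanConvex_of_immersion n X bX (roundMetric (n := n + 1) V) isRiemannian_roundMetric hΦ hΦ'
    (fun x ↦ scalarCurvature_roundMetric_pos V (by omega) (Φ x)) hΦb hν hνs hout hH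

/-- **Sweeney 2026, Prop. 1.2 from its topological half.** The named fact
`Sweeney2026_pscMeanConvex` follows (by `pscMeanConvex_of_immersion`) from the statement that
every compact contractible smooth `(n+1)`-manifold with boundary, `n ≥ 2` (Mazur if `n = 3`),
admits a codimension-`0` immersion `Φ` into some Riemannian `(n+1)`-manifold `(M, g_M)` of
positive scalar curvature along `Φ`, under which the boundary becomes a mean-convex hypersurface
with smooth outward unit normal — which is what the h-cobordism theorem (`X × I ≅ D^{n+2}`, so
`X ⊂ ∂(X × I) = S^{n+1}`; Mazur for `n = 3`, Perelman for `n = 2`) and Lawson–Michelsohn 1984,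
Thm. 1 (in the round `S^{n+1}`, a compact domain with a handle decomposition into handles of
codimension `≥ 2` is isotopic to one with boundary of positive mean curvature) provide, with
`M = S^{n+1}` round. The hypothesis is spelled out inline; it is the part of the argument that is
not in the tree. [cite: Sweeney2026, Prop. 1.2] -/
theorem Sweeney2026_pscMeanConvex_of_meanConvexImmersion
    (h : ∀ (n : ℕ), 2 ≤ n →
      ∀ (X : Type) [TopologicalSpace X] [T2Space X] [SecondCountableTopology X]
        [ChartedSpace (EuclideanHalfSpace (n + 1)) X] [IsManifold (𝓡∂ (n + 1)) ∞ X]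
        [CompactSpace X] [ContractibleSpace X]
        (bX : BoundaryData (𝓡∂ (n + 1)) X (𝓡 n)),
        (n = 3 → HasHandleDecomposition n X (fun k => if k ≤ 2 then 1 else 0)) →
        ∃ (M : Type) (_ : TopologicalSpace M) (_ : ChartedSpace (EuclideanSpace ℝ (Fin (n + 1))) M)
          (_ : IsManifold (𝓡 (n + 1)) ∞ M)
          (gM : PseudoRiemannianMetric (𝓡 (n + 1)) ∞ (EuclideanSpace ℝ (Fin (n + 1)))
            (TangentSpace (𝓡 (n + 1)) : M → Type _)) (_ : gM.HasLeviCivita)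
          (Φ : X → M) (_ : ContMDiff (𝓡∂ (n + 1)) (𝓡 (n + 1)) ∞ Φ)
          (_ : ∀ x, Injective (mfderiv (𝓡∂ (n + 1)) (𝓡 (n + 1)) Φ x))
          (hΦb : gM.IsSpacelikeImmersion (𝓡 n) (Φ ∘ bX.incl))
          (νM : NormalField (𝓡 (n + 1)) (Φ ∘ bX.incl)),
          gM.IsRiemannian ∧ (∀ x, 0 < gM.scalarCurvature (Φ x)) ∧
          gM.IsUnitNormal (𝓡 n) (Φ ∘ bX.incl) νM 1 ∧
          ContMDiff (𝓡 n) (𝓡 (n + 1)).tangent ∞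
            (fun z ↦ (TotalSpace.mk' (EuclideanSpace ℝ (Fin (n + 1))) (Φ (bX.incl z)) (νM z) :
              TangentBundle (𝓡 (n + 1)) M)) ∧
          (∀ z, (show EuclideanSpace ℝ (Fin (n + 1)) from
            (mfderiv (𝓡∂ (n + 1)) (𝓡 (n + 1)) Φ (bX.incl z)).inverse (νM z)) 0 < 0) ∧
          ∀ z, 0 < gM.meanCurvature (Φ ∘ bX.incl)
            PseudoRiemannianMetric.contMDiff_pullbackBilin_holds hΦb νM z) :
    Sweeney2026_pscMeanConvex := by
  intro n hn X _ _ _ _ _ _ _ bX hMazur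
  obtain ⟨M, _, _, _, gM, _, Φ, hΦ, hΦ', hΦb, νM, hgM, hS, hν, hνs, hout, hH⟩ :=
    h n hn X bX hMazur
  exact pscMeanConvex_of_immersion n X bX gM hgM hΦ hΦ' hS hΦb hν hνs hout hH

/-- **Sweeney 2026, Prop. 1.2 from Lawson–Michelsohn-type input in the round sphere.** The named
fact `Sweeney2026_pscMeanConvex` follows (by `pscMeanConvex_of_sphereImmersion`) from: every
compact contractible smooth `(n+1)`-manifold with boundary `X`, `n ≥ 2` (Mazur if `n = 3`), admits
a smooth map `Φ` with injective differentials into the round unit sphere `S^{n+1}` of some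
`(n+2)`-dimensional inner product space, under which the boundary is a spacelike immersion with a
smooth outward round-unit normal field of positive mean curvature. This hypothesis — spelled out
inline, NOT a new named fact — is what the sphere embedding of `X` (h-cobordism theorem:
`X × I ≅ D^{n+2}`, so `X ⊂ ∂(X × I) = S^{n+1}`, `n ≥ 4`; Mazur, `n = 3`; Perelman, `n = 2`)
followed by Lawson–Michelsohn 1984, Thm. 1 (a compact domain of `S^{n+1}` with a handle
decomposition into handles of codimension `≥ 2` is isotopic to one whose boundary has positive
mean curvature) provides; it is the part of the argument not in the tree.
[cite: Sweeney2026, Prop. 1.2] -/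
theorem Sweeney2026_pscMeanConvex_of_sphereImmersion
    (h : ∀ (n : ℕ), 2 ≤ n →
      ∀ (X : Type) [TopologicalSpace X] [T2Space X] [SecondCountableTopology X]
        [ChartedSpace (EuclideanHalfSpace (n + 1)) X] [IsManifold (𝓡∂ (n + 1)) ∞ X]
        [CompactSpace X] [ContractibleSpace X]
        (bX : BoundaryData (𝓡∂ (n + 1)) X (𝓡 n)),
        (n = 3 → HasHandleDecomposition n X (fun k => if k ≤ 2 then 1 else 0)) →
        ∃ (V : Type) (_ : NormedAddCommGroup V) (_ : InnerProductSpace ℝ V)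
          (_ : Fact (Module.finrank ℝ V = (n + 1) + 1))
          (_ : (roundMetric (n := n + 1) V).HasLeviCivita)
          (Φ : X → Metric.sphere (0 : V) 1) (_ : ContMDiff (𝓡∂ (n + 1)) (𝓡 (n + 1)) ∞ Φ)
          (_ : ∀ x, Injective (mfderiv (𝓡∂ (n + 1)) (𝓡 (n + 1)) Φ x))
          (hΦb : (roundMetric (n := n + 1) V).IsSpacelikeImmersion (𝓡 n) (Φ ∘ bX.incl))
          (νM : NormalField (𝓡 (n + 1)) (Φ ∘ bX.incl)),
          (roundMetric (n := n + 1) V).IsUnitNormal (𝓡 n) (Φ ∘ bX.incl) νM 1 ∧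
          ContMDiff (𝓡 n) (𝓡 (n + 1)).tangent ∞
            (fun z ↦ (TotalSpace.mk' (EuclideanSpace ℝ (Fin (n + 1))) (Φ (bX.incl z)) (νM z) :
              TangentBundle (𝓡 (n + 1)) (Metric.sphere (0 : V) 1))) ∧
          (∀ z, (show EuclideanSpace ℝ (Fin (n + 1)) from
            (mfderiv (𝓡∂ (n + 1)) (𝓡 (n + 1)) Φ (bX.incl z)).inverse (νM z)) 0 < 0) ∧
          ∀ z, 0 < (roundMetric (n := n + 1) V).meanCurvature (Φ ∘ bX.incl)
            PseudoRiemannianMetric.contMDiff_pullbackBilin_holds hΦb νM z) :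
    Sweeney2026_pscMeanConvex := by
  intro n hn X _ _ _ _ _ _ _ bX hMazur
  obtain ⟨V, _, _, _, _, Φ, hΦ, hΦ', hΦb, νM, hν, hνs, hout, hH⟩ := h n hn X bX hMazur
  exact pscMeanConvex_of_sphereImmersion n (by omega) X bX V hΦ hΦ' hΦb hν hνs hout hH

end Literature.Geometry.Riemannian

end
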